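import Summits.CriticalPhenomena.PercolationContinuityZ3.Theorems.PercNearOneGluingNoHeavyQuantFarGate3CertNDefs
import HarnessLib

/-!
# QUANT lane R8, front "FAR beyond trees", layer one — THE DEGREE-THREE GATE AT THE OBSERVER, LXVI-a: generic box-certificate engine over kernel N —
# DEGREE BOOKKEEPING and evaluation of the box-relative factor operations (`Fits`, `ev_mulY/…/ev_monoMul`)

builds on p205010 (kernel theorem, internal audit signed; external expert review pending)

Support file (`--supports stmt-CriticalPhenomena-4575`), seat `prim-quant-p1` (gen 35); memo
`run/shared/lean/prim/quant/prim-quant-p1-g35/FOR-LEAD-GATE3-PINCH.md`.  Files LXIII–LXV (incl. LXIV-b/c) only; standard axioms; no sorries; no definitions except the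
degree predicate `Fits` (pattern of file L-c `ChartCCertE`).
[this work].
-/

namespace Summit.CriticalPhenomena.PercolationContinuityZ3.Theorems

namespace Quant

namespace CertN

open BoxPolyP

/-! ## Degree bookkeeping -/

/-- `q` vanishes outside multidegree `(ny, na, nb, nc)` (indices as naturals with bounds, for `interval_cases`/`omega`). -/
def Fits (q : P4 ℤ) (ny na nb nc : ℕ) : Prop :=
  ∀ (i j k l : ℕ) (hi : i < 9) (hj : j < 3) (hk : k < 4) (hl : l < 4), q ⟨i, hi⟩ ⟨j, hj⟩ ⟨k, hk⟩ ⟨l, hl⟩ ≠ 0 → i ≤ ny ∧ j ≤ na ∧ k ≤ nb ∧ l ≤ nc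

/-- The Boolean table test implies `Fits`. [this work] -/
theorem fits_of_fitsB (q : P4 ℤ) (D : Deg) (h : fitsB q D = true) : Fits q D.y D.a D.b D.c := by
  intro i j k l hi hj hk hl hne
  simp only [fitsB, List.all_eq_true, List.mem_finRange, forall_const, Bool.or_eq_true, decide_eq_true_eq] at h
  rcases h ⟨i, hi⟩ ⟨j, hj⟩ ⟨k, hk⟩ ⟨l, hl⟩ with h1 | h2
  · exact h1
  · exact absurd h2 hne

/-- Weakening. [this work] -/
theorem fits_mono {q : P4 ℤ} {ny na nb nc ny' na' nb' nc' : ℕ} (h : Fits q ny na nb nc) (hy : ny ≤ ny') (ha : na ≤ na') (hb : nb ≤ nb')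
    (hc : nc ≤ nc') : Fits q ny' na' nb' nc' := by
  intro i j k l hi hj hk hl hne
  obtain ⟨h1, h2, h3, h4⟩ := h i j k l hi hj hk hl hne
  omega

/-- `zero` fits everything. [this work] -/
theorem fits_zero (ny na nb nc : ℕ) : Fits BoxPolyP.zero ny na nb nc := fun _ _ _ _ _ _ _ _ hne => (hne rfl).elim

/-- `add` preserves `Fits`. [this work] -/
theorem fits_add {q q' : P4 ℤ} {ny na nb nc : ℕ} (h1 : Fits q ny na nb nc) (h2 : Fits q' ny na nb nc) : Fits (add q q') ny na nb nc := by
  intro i j k l hi hj hk hl hne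
  by_cases hq : q ⟨i, hi⟩ ⟨j, hj⟩ ⟨k, hk⟩ ⟨l, hl⟩ = 0
  · apply h2 i j k l hi hj hk hl
    intro h0; apply hne
    show q _ _ _ _ + q' _ _ _ _ = 0
    rw [hq, h0, add_zero]
  · exact h1 i j k l hi hj hk hl hq

/-- `smul` preserves `Fits`. [this work] -/
theorem fits_smul {q : P4 ℤ} {ny na nb nc : ℕ} (s : ℤ) (h1 : Fits q ny na nb nc) : Fits (smul s q) ny na nb nc := by
  intro i j k l hi hj hk hl hne
  apply h1 i j k l hi hj hk hl
  intro h0; apply hne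
  show s * q _ _ _ _ = 0
  rw [h0, mul_zero]

/-- `shiftY` raises the `y`-degree by one. [this work] -/
theorem fits_shiftY {q : P4 ℤ} {ny na nb nc : ℕ} (h : Fits q ny na nb nc) : Fits (shiftY q) (ny + 1) na nb nc := by
  intro i j k l hi hj hk hl hne
  interval_cases i
  · exact absurd rfl hne
  · have H := h 0 j k l (by norm_num) hj hk hl hne; omega
  · have H := h 1 j k l (by norm_num) hj hk hl hne; omega
  · have H := h 2 j k l (by norm_num) hj hk hl hne; omega
  · have H := h 3 j k l (by norm_num) hj hk hl hne; omega
  · have H := h 4 j k l (by norm_num) hj hk hl hne; omega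
  · have H := h 5 j k l (by norm_num) hj hk hl hne; omega
  · have H := h 6 j k l (by norm_num) hj hk hl hne; omega
  · have H := h 7 j k l (by norm_num) hj hk hl hne; omega

/-- `shiftA` raises the `a`-degree by one. [this work] -/
theorem fits_shiftA {q : P4 ℤ} {ny na nb nc : ℕ} (h : Fits q ny na nb nc) : Fits (shiftA q) ny (na + 1) nb nc := by
  intro i j k l hi hj hk hl hne
  interval_cases j
  · exact absurd rfl hne
  · have H := h i 0 k l hi (by norm_num) hk hl hne; omega
  · have H := h i 1 k l hi (by norm_num) hk hl hne; omega

/-- `shiftB` raises the `b`-degree by one. [this work] -/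
theorem fits_shiftB {q : P4 ℤ} {ny na nb nc : ℕ} (h : Fits q ny na nb nc) : Fits (shiftB q) ny na (nb + 1) nc := by
  intro i j k l hi hj hk hl hne
  interval_cases k
  · exact absurd rfl hne
  · have H := h i j 0 l hi hj (by norm_num) hl hne; omega
  · have H := h i j 1 l hi hj (by norm_num) hl hne; omega
  · have H := h i j 2 l hi hj (by norm_num) hl hne; omega

/-- `shiftC` raises the `c`-degree by one. [this work] -/
theorem fits_shiftC {q : P4 ℤ} {ny na nb nc : ℕ} (h : Fits q ny na nb nc) : Fits (shiftC q) ny na nb (nc + 1) := by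
  intro i j k l hi hj hk hl hne
  interval_cases l
  · exact absurd rfl hne
  · have H := h i j k 0 hi hj hk (by norm_num) hne; omega
  · have H := h i j k 1 hi hj hk (by norm_num) hne; omega
  · have H := h i j k 2 hi hj hk (by norm_num) hne; omega

/-! ## Evaluation of the tensor operations -/

section Real

variable (y a b c : ℝ)

/-- Casts commute with `add`. [this work] -/
theorem castP4_add (q q' : P4 ℤ) : castP4 (add q q') = add (castP4 q) (castP4 q') := by
  funext i j k l; simp [castP4, add]

/-- Casts commute with `smul`. [this work] -/
theorem castP4_smul (s : ℤ) (q : P4 ℤ) : castP4 (smul s q) = smul (s : ℝ) (castP4 q) := by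
  funext i j k l; simp [castP4, smul]

/-- Cast of `zero`. [this work] -/
theorem castP4_zero : castP4 BoxPolyP.zero = (BoxPolyP.zero : P4 ℝ) := by
  funext i j k l; simp [castP4, BoxPolyP.zero]

/-- Casts commute with `shiftY`. [this work] -/
theorem castP4_shiftY (q : P4 ℤ) : castP4 (shiftY q) = shiftY (castP4 q) := by
  funext i j k l; fin_cases i <;> simp [castP4, shiftY]

/-- Casts commute with `shiftA`. [this work] -/
theorem castP4_shiftA (q : P4 ℤ) : castP4 (shiftA q) = shiftA (castP4 q) := by
  funext i j k l; fin_cases j <;> simp [castP4, shiftA]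

/-- Casts commute with `shiftB`. [this work] -/
theorem castP4_shiftB (q : P4 ℤ) : castP4 (shiftB q) = shiftB (castP4 q) := by
  funext i j k l; fin_cases k <;> simp [castP4, shiftB]

/-- Casts commute with `shiftC`. [this work] -/
theorem castP4_shiftC (q : P4 ℤ) : castP4 (shiftC q) = shiftC (castP4 q) := by
  funext i j k l; fin_cases l <;> simp [castP4, shiftC]

/-- `ev` is additive. [this work] -/
theorem ev_add (q q' : P4 ℤ) : ev (add q q') y a b c = ev q y a b c + ev q' y a b c := by
  unfold ev; rw [castP4_add, eval4_add]

/-- `ev` commutes with `smul`. [this work] -/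
theorem ev_smul (s : ℤ) (q : P4 ℤ) : ev (smul s q) y a b c = (s : ℝ) * ev q y a b c := by
  unfold ev; rw [castP4_smul, eval4_smul]

/-- `ev zero = 0`. [this work] -/
theorem ev_zero : ev BoxPolyP.zero y a b c = 0 := by
  unfold ev; rw [castP4_zero, eval4_zero]

/-- `ev` of `shiftY` (no overflow). [this work] -/
theorem ev_shiftY {q : P4 ℤ} {ny na nb nc : ℕ} (h : Fits q ny na nb nc) (hny : ny ≤ 7) : ev (shiftY q) y a b c = y * ev q y a b c := by
  unfold ev; rw [castP4_shiftY]
  apply eval4_shiftY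
  intro j k l
  have hz : q 8 j k l = 0 := by
    by_contra hne
    have H := h 8 j.val k.val l.val (by norm_num) j.isLt k.isLt l.isLt hne
    omega
  simp [castP4, hz]

/-- `ev` of `shiftA` (no overflow). [this work] -/
theorem ev_shiftA {q : P4 ℤ} {ny na nb nc : ℕ} (h : Fits q ny na nb nc) (hna : na ≤ 1) : ev (shiftA q) y a b c = a * ev q y a b c := by
  unfold ev; rw [castP4_shiftA]
  apply eval4_shiftA
  intro i k l
  have hz : q i 2 k l = 0 := by
    by_contra hne
    have H := h i.val 2 k.val l.val i.isLt (by norm_num) k.isLt l.isLt hne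
    omega
  simp [castP4, hz]

/-- `ev` of `shiftB` (no overflow). [this work] -/
theorem ev_shiftB {q : P4 ℤ} {ny na nb nc : ℕ} (h : Fits q ny na nb nc) (hnb : nb ≤ 2) : ev (shiftB q) y a b c = b * ev q y a b c := by
  unfold ev; rw [castP4_shiftB]
  apply eval4_shiftB
  intro i j l
  have hz : q i j 3 l = 0 := by
    by_contra hne
    have H := h i.val j.val 3 l.val i.isLt j.isLt (by norm_num) l.isLt hne
    omega
  simp [castP4, hz]

/-- `ev` of `shiftC` (no overflow). [this work] -/
theorem ev_shiftC {q : P4 ℤ} {ny na nb nc : ℕ} (h : Fits q ny na nb nc) (hnc : nc ≤ 2) : ev (shiftC q) y a b c = c * ev q y a b c := by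
  unfold ev; rw [castP4_shiftC]
  apply eval4_shiftC
  intro i j k
  have hz : q i j k 3 = 0 := by
    by_contra hne
    have H := h i.val j.val k.val 3 i.isLt j.isLt k.isLt (by norm_num) hne
    omega
  simp [castP4, hz]

variable (d : Cert)

/-- `mulY` multiplies by `D·y − Y0` and raises the `y`-degree. [this work] -/
theorem ev_mulY {q : P4 ℤ} {ny na nb nc : ℕ} (h : Fits q ny na nb nc) (hny : ny ≤ 7) :
    ev (mulY d q) y a b c = ((d.D : ℝ) * y - d.Y0) * ev q y a b c ∧ Fits (mulY d q) (ny + 1) na nb nc := by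
  refine ⟨?_, fits_add (fits_smul _ (fits_shiftY h)) (fits_smul _ (fits_mono h (by omega) le_rfl le_rfl le_rfl))⟩
  unfold mulY; rw [ev_add, ev_smul, ev_smul, ev_shiftY y a b c h hny]; push_cast; ring

/-- `mulA` multiplies by `D·a − A0` and raises the `a`-degree. [this work] -/
theorem ev_mulA {q : P4 ℤ} {ny na nb nc : ℕ} (h : Fits q ny na nb nc) (hna : na ≤ 1) :
    ev (mulA d q) y a b c = ((d.D : ℝ) * a - d.A0) * ev q y a b c ∧ Fits (mulA d q) ny (na + 1) nb nc := by
  refine ⟨?_, fits_add (fits_smul _ (fits_shiftA h)) (fits_smul _ (fits_mono h le_rfl (by omega) le_rfl le_rfl))⟩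
  unfold mulA; rw [ev_add, ev_smul, ev_smul, ev_shiftA y a b c h hna]; push_cast; ring

/-- `mulB` multiplies by `D·b − B0` and raises the `b`-degree. [this work] -/
theorem ev_mulB {q : P4 ℤ} {ny na nb nc : ℕ} (h : Fits q ny na nb nc) (hnb : nb ≤ 2) :
    ev (mulB d q) y a b c = ((d.D : ℝ) * b - d.B0) * ev q y a b c ∧ Fits (mulB d q) ny na (nb + 1) nc := by
  refine ⟨?_, fits_add (fits_smul _ (fits_shiftB h)) (fits_smul _ (fits_mono h le_rfl le_rfl (by omega) le_rfl))⟩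
  unfold mulB; rw [ev_add, ev_smul, ev_smul, ev_shiftB y a b c h hnb]; push_cast; ring

/-- `mulC` multiplies by `D·c − C0` and raises the `c`-degree. [this work] -/
theorem ev_mulC {q : P4 ℤ} {ny na nb nc : ℕ} (h : Fits q ny na nb nc) (hnc : nc ≤ 2) :
    ev (mulC d q) y a b c = ((d.D : ℝ) * c - d.C0) * ev q y a b c ∧ Fits (mulC d q) ny na nb (nc + 1) := by
  refine ⟨?_, fits_add (fits_smul _ (fits_shiftC h)) (fits_smul _ (fits_mono h le_rfl le_rfl le_rfl (by omega)))⟩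
  unfold mulC; rw [ev_add, ev_smul, ev_smul, ev_shiftC y a b c h hnc]; push_cast; ring

/-- `powY n` (`n ≤ 2`) multiplies by `(D·y − Y0)^n`. [this work] -/
theorem ev_powY {q : P4 ℤ} {ny na nb nc : ℕ} (n : ℕ) (hn : n ≤ 2) (h : Fits q ny na nb nc) (hny : ny + n ≤ 8) :
    ev (powY d n q) y a b c = ((d.D : ℝ) * y - d.Y0) ^ n * ev q y a b c ∧ Fits (powY d n q) (ny + n) na nb nc := by
  rcases Nat.lt_or_ge n 1 with h0 | h1
  · have hn0 : n = 0 := by omega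
    subst hn0
    have e0 : powY d 0 q = q := by simp [powY]
    rw [e0]
    exact ⟨by ring, by simpa using h⟩
  · rcases Nat.lt_or_ge n 2 with h1' | h2
    · have hn1 : n = 1 := by omega
      subst hn1
      have e1 : powY d 1 q = mulY d q := by simp [powY]
      rw [e1, pow_one]
      exact ev_mulY y a b c d h (by omega)
    · have hn2 : n = 2 := by omega
      subst hn2
      have e2 : powY d 2 q = mulY d (mulY d q) := by simp [powY]
      rw [e2]
      have h₁ := ev_mulY y a b c d h (by omega)
      have h₂ := ev_mulY y a b c d h₁.2 (by omega)
      refine ⟨?_, fits_mono h₂.2 (by omega) le_rfl le_rfl le_rfl⟩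
      rw [h₂.1, h₁.1]; ring

/-- `optA bit` multiplies by `(D·a − A0)^bit`. [this work] -/
theorem ev_optA {q : P4 ℤ} {ny na nb nc : ℕ} (bit : ℕ) (hbit : bit ≤ 1) (h : Fits q ny na nb nc) (hna : na + bit ≤ 2) :
    ev (optA d bit q) y a b c = ((d.D : ℝ) * a - d.A0) ^ bit * ev q y a b c ∧ Fits (optA d bit q) ny (na + bit) nb nc := by
  rcases Nat.lt_or_ge bit 1 with h0 | h1
  · have hb0 : bit = 0 := by omega
    subst hb0
    have e0 : optA d 0 q = q := by simp [optA]
    rw [e0]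
    exact ⟨by ring, by simpa using h⟩
  · have hb1 : bit = 1 := by omega
    subst hb1
    have e1 : optA d 1 q = mulA d q := by simp [optA]
    rw [e1, pow_one]
    exact ev_mulA y a b c d h (by omega)

/-- `optB bit` multiplies by `(D·b − B0)^bit`. [this work] -/
theorem ev_optB {q : P4 ℤ} {ny na nb nc : ℕ} (bit : ℕ) (hbit : bit ≤ 1) (h : Fits q ny na nb nc) (hnb : nb + bit ≤ 3) :
    ev (optB d bit q) y a b c = ((d.D : ℝ) * b - d.B0) ^ bit * ev q y a b c ∧ Fits (optB d bit q) ny na (nb + bit) nc := by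
  rcases Nat.lt_or_ge bit 1 with h0 | h1
  · have hb0 : bit = 0 := by omega
    subst hb0
    have e0 : optB d 0 q = q := by simp [optB]
    rw [e0]
    exact ⟨by ring, by simpa using h⟩
  · have hb1 : bit = 1 := by omega
    subst hb1
    have e1 : optB d 1 q = mulB d q := by simp [optB]
    rw [e1, pow_one]
    exact ev_mulB y a b c d h (by omega)

/-- `optC bit` multiplies by `(D·c − C0)^bit`. [this work] -/
theorem ev_optC {q : P4 ℤ} {ny na nb nc : ℕ} (bit : ℕ) (hbit : bit ≤ 1) (h : Fits q ny na nb nc) (hnc : nc + bit ≤ 3) :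
    ev (optC d bit q) y a b c = ((d.D : ℝ) * c - d.C0) ^ bit * ev q y a b c ∧ Fits (optC d bit q) ny na nb (nc + bit) := by
  rcases Nat.lt_or_ge bit 1 with h0 | h1
  · have hb0 : bit = 0 := by omega
    subst hb0
    have e0 : optC d 0 q = q := by simp [optC]
    rw [e0]
    exact ⟨by ring, by simpa using h⟩
  · have hb1 : bit = 1 := by omega
    subst hb1
    have e1 : optC d 1 q = mulC d q := by simp [optC]
    rw [e1, pow_one]
    exact ev_mulC y a b c d h (by omega)

/-- **`monoMul e` multiplies by the box-relative factor `fac e`** (when the factor keeps the degree inside the container). [this work] -/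
theorem ev_monoMul {q : P4 ℤ} {D : Deg} (h : Fits q D.y D.a D.b D.c) (e : ℕ) (he : degOk D e = true) :
    ev (monoMul d e q) y a b c = fac d e y a b c * ev q y a b c := by
  simp only [degOk, decide_eq_true_eq] at he
  obtain ⟨hy, ha, hb, hc⟩ := he
  have h₁ := ev_powY y a b c d (e % 3) (by omega) h hy
  have h₂ := ev_optA y a b c d (e / 3 % 2) (by omega) h₁.2 ha
  have h₃ := ev_optB y a b c d (e / 6 % 2) (by omega) h₂.2 hb
  have h₄ := ev_optC y a b c d (e / 12 % 2) (by omega) h₃.2 hc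
  unfold monoMul fac
  rw [h₄.1, h₃.1, h₂.1, h₁.1]; ring

end Real

end CertN

end Quant

end Summit.CriticalPhenomena.PercolationContinuityZ3.Theorems
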